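import Summits.ABC.IUTFork.Cor312PilotKummerSplitWitness
import Summits.ABC.IUTFork.Repair.CandMochizuki33
import Summits.ABC.IUTFork.Repair.CandMochizuki30
import Summits.ABC.IUTFork.Repair.CandMochizuki31
import HarnessLib
/-!
# REPAIR branch B1 / CandMochizuki32Split — the P♮₁ COLUMN, part I (abc-iut-w5-d230's SPLIT natural bed: S through ONE (Ind1) CAPSULE
# PERMUTATION): the EXACT HULL of P♮₁, and the cells of rp-m3's rows RP-M32a/b/c, RP-X07c (+M32d), RP-M06, RP-M31

PROOF-ONLY file (no definition, no `Prop` fact; class `Mochizuki`, sub-cell B1, seat abc-iut-rp-m3 gen 3; abc-iut-rp-plan FOLD #1 (gen 2)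
09:49:51Z (D5) «P♮₁ column for the m-rows: m3»; REPAIR-SPEC v0.4 §3 PROFILE RULE; sequel `CandMochizuki32SplitB1` = the sibling rows
M01–M47 of rp-m1/m2/m4). TAKES NO SIDE between Mochizuki, Scholze–Stix, Joshi, Dupuy–Hilado or anyone; nothing here asserts abc or
[IUTchIII] Cor. 3.12 proved or refuted; candidates are hypotheses — typed ≠ proved, instantiated ≠ endorsed. Every cell is a closed theorem
about TOY MODEL DATA, BY NAME on the bed `Cor312PilotKummerSplit{Shells,Model,Thm311,Witness}` (p431201/p431483/p431494/p433797:
`splitShells` — two valuations over one place, split tensor packets `(ℚ²)^{⊗(j+1)}`, TRIVIAL Ism and strip-automorphisms —, `swapFamily ∈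
(Ind1)` the swap of the capsule indices `0` and `j`, `qDatumSplit := swapFamily · {Θ-point}`, `splitSetting`, `boxRegion`,
`splitSetting_pinnedRegions3`, `splitSetting_pilotKummerIndRelated`, `splitSetting_pilotKummerCompat`, `splitSetting_statement_strict`,
`splitSetting_not_identifiedReading`, engine `satNatural₁_of_holds_at_splitSetting`) and on the LANDED candidate files `Repair.CandMochizuki32`
(p427902: `H`/`H'`/`H''`), `Repair.CandMochizuki33` (p430360/p431548: `AO4`, the inference §3), `Repair.CandMochizuki30` (p428615: the cap
`H s`), `Repair.CandMochizuki31` (p429332: the class `H N`). Nothing restated; DEFS-FREEZE kept.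

WHY THIS BED: P♮₁ is the one bed of record on which S holds NON-identified through PRINT'S OWN moving indeterminacy — an (Ind1) capsule
permutation of a split packet ([IUTchIII] Thm. 3.11 (i) p. 154; [IUTchIV] Thm. 1.10 Step (v) «symmetrizing with respect to the choice of
i† ∈ I»; Dupuy–Hilado §4.7) — with a RIGIDIFIED unit group (Ism = {1}) and a hull STRICTLY larger than every single possible image
(w5-d230 proved strictness only). §1 computes that hull EXACTLY: at a label `j ∈ 𝔽_l^⋇` the common deep set of the (Ind1)-orbit of the
Θ-box is the single all-shallow coordinate `c₀` (`deepSet_sUnion_possibleImages`: a coordinate deep for every transposition-translate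
vanishes at every index), so `ⁿ˒°𝒰_j = box {c₀}` (`split_thetaHull_eq`) has log-volume `−2` (`split_hull_logvol`) against `−1 − 2^j` for the
Θ-box AND for the q-box (`card_DTheta`): the isometric (Ind1)-orbit inflates the hull by EXACTLY `2^j − 1` — `1` at `j = 1`, `3` at `j = 2`
(`split_inflation`) — while S holds on the nose.

CELLS (EVAL-LOG column «P♮₁»; ✓ HOLDS / ✗ FAILS; bed (`splitFull`, `splitSetting`, `boxRegion`, `qDatumSplit`)):
* RP-M32a `H` ✓ (`M32a_split`; `H ⟺ S` under the pins) · RP-M32b `H'` ✓ · RP-M32c `H''` ✓ (+ T-c grade SAT♮₁ `M32c_satNatural₁`) — the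
  three Rmk 3.12.2 (ii) readings hold where S holds, as at P♮.
* RP-X07c `AO4` ✗ (`not_AO4_split`): identification WITHOUT indeterminacy fails where S holds — STRONGER than S; third separating bed after
  P♮ and U. (X07a/b hold at every setting, `CandMochizuki33.ao1_holds`/`ao2_holds`.)
* RP-M32d (`inference_premise_not_necessary_split`): the «image of ∧» principle holds for every single carrier (as everywhere), its premise
  (AOΘ4) FAILS, and yet (f^itw)'s first arrow HOLDS at region and hull level — the two labelled carriers are related by the (Ind1) capsule
  permutation instead of being merged. With `CandMochizuki33.inference_fails_with_two_carriers_at_CM` (premise ✗, conclusion ✗): over the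
  typed interface the single-carrier premise is neither sufficient-with-two-carriers (CM) nor necessary (P♮₁) for (f^itw); print's polarity
  «(AOΘ1) ∧ (AOΘ2) ∧ ¬(AOΘ4) ∧ (f^itw)» ([EssLgc] §3.4 p. 96) is CONSISTENT exactly on beds with a carrier-moving indeterminacy (P♮: the
  sign; P♮₁: print's (Ind1)).
* RP-M06 `CandMochizuki30.H s ⟺ ∀ j, 2^j − 1 ≤ s_j` (`M06_split_iff`): the ZERO cap FAILS here (`not_M06_zero_split`) while it HOLDS at CM
  (`CandMochizuki30.H_pinned_zero`) — the first bed of record at which [IUTchIV] Step (v)'s cap must be POSITIVE, and it is, by an ISOMETRIC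
  (Ind1) (Step (x) holds, `splitData_logvolInvariant`); the cap `2^j − 1` holds with equality (`M06_split_exact`).
* RP-M31 `CandMochizuki31.H N` ✗ for EVERY `N` (`not_M31_split`): Θ-box and q-box have the SAME volume, so P♮₁ lies outside every
  `N·j²`-scaled class — its inflation is pure frame/orbit, not scaling.
Package `profile_split_m3`. READING (neutral): the column records which m3 rows SEE the (Ind1) mechanism; no verdict word moves.
[claim: Mochizuki2012, status: disputed] for every IUT noun; [cite: ScholzeStix2018, §2.2 pp. 9–10] for the countermodel side;
[cite: DupuyHilado2020, §4.7] for the (Ind1) reading.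
-/

noncomputable section

open Set

namespace Summit.ABC.IUTFork.Repair.CandMochizuki32Split

open Thm311 Cor312 Cor312Vol Cor312.Checks Cor312.IdentifiedNonVacuity Cor312Vol.NaiveWitness Cor312Vol.PinnedWitness
  Cor312Vol.SplitWitness Repair.CandMochizuki32 Literature.IUT.LogThetaLattice

/-! ## 1. The holomorphic hull of P♮₁ EXACTLY: the common deep set of the (Ind1)-orbit is the all-shallow coordinate -/

/-- The all-shallow coordinate `c₀ ≡ false` lies in every transported Θ-deep set `permD σ (DTheta j)`. [folklore] -/
theorem const_false_mem_permD {j : splitIndex.Label} (σ : Equiv.Perm (splitIndex.Caps j)) :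
    (fun _ => false) ∈ permD σ (DTheta j) := by
  rw [mem_permD_iff]; unfold DTheta; rw [Finset.mem_filter]; exact ⟨Finset.mem_univ _, rfl⟩

/-- For every capsule index `i` some (Ind1)-family acts at `(j, v_ℚ)` by the transposition `(i j)`. [folklore] -/
theorem exists_ind1_acts_by_swap (j : splitIndex.Label) (vQ : splitIndex.VQ) (i : splitIndex.Caps j) :
    ∃ Φ ∈ Setting.indGroup splitSituation, ∀ x, Φ j vQ x = splitShells.permute j vQ (Equiv.swap i (Fin.last _)) x := by
  let τ : ∀ j' : splitIndex.Label, Equiv.Perm (splitIndex.Caps j') :=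
    Function.update (fun j' => (Equiv.refl _ : Equiv.Perm (splitIndex.Caps j'))) j (Equiv.swap i (Fin.last _))
  have hτ : τ j = Equiv.swap i (Fin.last _) := Function.update_self _ _ _
  exact ⟨permFamily τ, Subgroup.subset_closure (Or.inl (permFamily_mem_Ind1Family τ)), fun x => by
    show splitShells.permute j vQ (τ j) x = _; rw [hτ]⟩

/-- **The common deep set of the possible images at a label of `𝔽_l^⋇` is `{c₀}`** (`c₀ ≡ false`): a coordinate deep for the whole
(Ind1)-orbit of the Θ-box is deep for every transposition-translate, hence vanishes at every index. [folklore] -/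
theorem deepSet_sUnion_possibleImages {j : splitIndex.Label} (hj : j ≠ 0) (vQ : splitIndex.VQ) :
    deepSet (⋃₀ splitSetting.possibleImages j vQ) = {fun _ => false} := by
  ext c
  rw [mem_deepSet_iff, Finset.mem_singleton]
  constructor
  · intro h
    funext i
    obtain ⟨Φ, hΦ, hσ⟩ := exists_ind1_acts_by_swap j vQ i
    have hU : Φ j vQ '' splitSetting.thetaRegion3 j vQ ∈ splitSetting.possibleImages j vQ := ⟨Φ, hΦ, rfl⟩
    have hc : c ∈ deepSet (Φ j vQ '' splitSetting.thetaRegion3 j vQ) :=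
      (mem_deepSet_iff _ c).2 ((Set.subset_sUnion_of_mem hU).trans h)
    rw [(splitSetting_regions_of_ne_zero hj vQ).1, deepSet_image_of_perm hσ, deepSet_box_DTheta hj, mem_permD_iff] at hc
    unfold DTheta at hc
    rw [Finset.mem_filter] at hc
    simpa [Equiv.swap_apply_right] using hc.2
  · rintro rfl
    intro x hx
    obtain ⟨U, hU, hxU⟩ := hx
    obtain ⟨σ, rfl⟩ := (splitSetting_possibleImages hj vQ).1 U hU
    exact box_antitone (Finset.singleton_subset_iff.2 (const_false_mem_permD σ)) hxU

/-- **The hull `ⁿ˒°𝒰_{j,v_ℚ}` of P♮₁ at a label of `𝔽_l^⋇` is the box deep at the single coordinate `c₀`.** [folklore] -/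
theorem split_thetaHull_eq {j : splitIndex.Label} (hj : j ≠ 0) (vQ : splitIndex.VQ) :
    splitSetting.thetaHull j vQ = box {fun _ => false} := by
  rw [(splitSetting_thetaHull hj vQ).1, deepSet_sUnion_possibleImages hj vQ]

/-- The deep set of the hull is `{c₀}` (least box; the union of the possible images lies in the hull). [folklore] -/
theorem deepSet_thetaHull {j : splitIndex.Label} (hj : j ≠ 0) (vQ : splitIndex.VQ) :
    deepSet (splitSetting.thetaHull j vQ) = {fun _ => false} := by
  refine Finset.Subset.antisymm ?_ fun c hc => ?_
  · rw [← deepSet_sUnion_possibleImages hj vQ]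
    exact deepSet_antitone ((splitSetting.frame j vQ).subset_hull _)
  · rw [Finset.mem_singleton] at hc; subst hc
    rw [mem_deepSet_iff, split_thetaHull_eq hj vQ]

/-- **The hull's log-volume is `−2`** at every label of `𝔽_l^⋇`. [folklore] -/
theorem split_hull_logvol {j : splitIndex.Label} (hj : j ≠ 0) (vQ : splitIndex.VQ) :
    (splitFull.toLatticeSituation.D splitSetting.n).logvol j vQ (splitSetting.thetaHull j vQ) = -2 := by
  show splitVol j vQ (splitSetting.thetaHull j vQ) = -2
  unfold splitVol
  rw [if_pos (by rw [split_thetaHull_eq hj vQ]; exact box_antitone (Finset.empty_subset _)), deepSet_thetaHull hj vQ,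
    Finset.card_singleton]
  norm_num

/-- The local hull volume `thetaLocal = −2` at every label of `𝔽_l^⋇`. [folklore] -/
theorem split_thetaLocal (i : Fin splitIndex.lstar) (vQ : splitIndex.VQ) :
    splitSetting.thetaLocal (Setting.labelSucc i) vQ = ((-2 : ℝ) : WithTop ℝ) := by
  unfold Setting.thetaLocal
  rw [if_pos (splitSetting_hullDefined _ vQ), split_hull_logvol (Setting.labelSucc_ne_zero i) vQ]

/-- The (Ind3)-enlarged Θ-image has the q-pilot's local volume `−1 − #DTheta j` (honesty vector of P♮₁, last clause). [folklore] -/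
theorem split_thetaRegion3_logvol (i : Fin splitIndex.lstar) (vQ : splitIndex.VQ) :
    (splitFull.toLatticeSituation.D splitSetting.n).logvol _ vQ (splitSetting.thetaRegion3 (Setting.labelSucc i) vQ) =
      -1 - ((DTheta (Setting.labelSucc i)).card : ℝ) := by
  rw [split_honesty_vector.2.2.2.2.2.2 i vQ, splitSetting_qLocal]

/-- `#DTheta j = 2^j` on `𝔽_l^⋇` (`l⋇ = 2`: `2` at `j = 1`, `4` at `j = 2`). [folklore] -/
theorem card_DTheta (i : Fin splitIndex.lstar) : (DTheta (Setting.labelSucc i)).card = 2 ^ ((i : ℕ) + 1) := by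
  revert i; decide

/-- **THE INFLATION OF P♮₁**: `logvol(ⁿ˒°𝒰_j) − logvol(Θ-image_j) = #DTheta j − 1 = 2^j − 1` at every label `j ∈ 𝔽_l^⋇` — produced by an
ISOMETRIC (Ind1) capsule permutation (Step (x) holds: `splitData_logvolInvariant`). [folklore] -/
theorem split_inflation (i : Fin splitIndex.lstar) (vQ : splitIndex.VQ) :
    (splitFull.toLatticeSituation.D splitSetting.n).logvol _ vQ (splitSetting.thetaHull (Setting.labelSucc i) vQ) -
        (splitFull.toLatticeSituation.D splitSetting.n).logvol _ vQ (splitSetting.thetaRegion3 (Setting.labelSucc i) vQ) =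
      (2 : ℝ) ^ ((i : ℕ) + 1) - 1 := by
  rw [split_hull_logvol (Setting.labelSucc_ne_zero i) vQ, split_thetaRegion3_logvol, card_DTheta]
  push_cast
  ring

/-! ## 2. The cells of rp-m3's rows: RP-M32a/b/c, RP-X07c, RP-M32d, RP-M06, RP-M31 -/

/-- **RP-M32a at P♮₁: `H` HOLDS** (`H ⟺ S` under Thm 3.11 (ii)(b) and the pins, `CandMochizuki32.H_of_S`; S holds through `swapFamily`). [folklore] -/
theorem M32a_split : H splitFull.toLatticeSituation splitSetting boxRegion qDatumSplit :=
  H_of_S _ _ _ _ split_honesty_vector.1 splitSetting_pinnedRegions3 splitSetting_pilotKummerIndRelated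

/-- Reading R3 at every label of P♮₁ (the q-region is a possible image). [folklore] -/
theorem split_reading3 (j : splitIndex.Label) (vQ : splitIndex.VQ) : splitSetting.qRegion j vQ ∈ splitSetting.possibleImages j vQ :=
  (H_iff_reading3 _ _ _ _).1 M32a_split j vQ

/-- **RP-M32b at P♮₁: `H'` HOLDS.** [folklore] -/
theorem M32b_split : H' splitFull.toLatticeSituation splitSetting boxRegion qDatumSplit := H'_of_H _ _ _ _ M32a_split

/-- **RP-M32c at P♮₁: `H''` HOLDS.** [folklore] -/
theorem M32c_split : H'' splitFull.toLatticeSituation splitSetting boxRegion qDatumSplit := H''_of_H _ _ _ _ M32a_split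

/-- **RP-X07c at P♮₁: `AO4` FAILS** — at the label `1` the q-box (deep off slot `0`) is no Kummer image `thetaRegion m = box (DTheta 1)` of the
Θ-pilot (w5-d230's `splitSetting_regions_ne`): identification without indeterminacy fails where S holds. [folklore] -/
theorem not_AO4_split : ¬ CandMochizuki33.AO4 splitFull.toLatticeSituation splitSetting boxRegion qDatumSplit := by
  intro h
  have hj := Setting.labelSucc_ne_zero (⟨0, by decide⟩ : Fin splitIndex.lstar)
  obtain ⟨m, e⟩ := (CandMochizuki33.AO4_iff _ _ _ _).1 h (Setting.labelSucc ⟨0, by decide⟩) ()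
  rw [splitSetting_thetaRegion, thetaRegionSplit_one_of_ne_zero hj, (splitSetting_regions_of_ne_zero hj ()).2,
    ← boxRegion_theta hj, ← boxRegion_qDatumSplit hj] at e
  exact splitSetting_regions_ne hj () e

/-- **RP-M32d at P♮₁: the single-carrier premise is NOT NECESSARY for (f^itw).** The «image of ∧» principle holds for every single carrier
at both levels (as everywhere), its premise (AOΘ4) FAILS, and yet (f^itw)'s first arrow HOLDS at region and hull level — the two labelled
carriers are related by the (Ind1) capsule permutation instead of being merged. Compare `CandMochizuki33.inference_fails_with_two_carriers_at_CM`
(premise ✗, conclusion ✗). [claim: Mochizuki2012, status: disputed] -/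
theorem inference_premise_not_necessary_split :
    CandMochizuki33.AO1 splitFull.toLatticeSituation splitSetting boxRegion qDatumSplit ∧
      (∀ (j : splitIndex.Label) (vQ : splitIndex.VQ) (U : Set (splitShells.Packet j vQ)), (itwRegion splitSetting j vQ U).ImageOfCitw) ∧
      (∀ (j : splitIndex.Label) (vQ : splitIndex.VQ) (U : Set (splitShells.Packet j vQ)), (itwHull splitSetting j vQ U).ImageOfCitw) ∧
      ¬ CandMochizuki33.AO4 splitFull.toLatticeSituation splitSetting boxRegion qDatumSplit ∧
      H splitFull.toLatticeSituation splitSetting boxRegion qDatumSplit ∧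
      H'' splitFull.toLatticeSituation splitSetting boxRegion qDatumSplit :=
  ⟨CandMochizuki33.ao1_holds _ _ _ _,
    fun j vQ U => CandMochizuki33.imageOfCitw_region splitFull.toLatticeSituation splitSetting boxRegion split_honesty_vector.1
      splitSetting_thetaPinned j vQ U,
    fun j vQ U => CandMochizuki33.imageOfCitw_hull splitFull.toLatticeSituation splitSetting j vQ U, not_AO4_split, M32a_split, M32c_split⟩

/-- **RP-M06 at P♮₁: [IUTchIV] Step (v)'s cap `H s` HOLDS iff `2^j − 1 ≤ s_j` at both labels** (`split_inflation`). [folklore] -/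
theorem M06_split_iff (s : Fin splitIndex.lstar → splitIndex.VQ → ℝ) :
    CandMochizuki30.H splitFull.toLatticeSituation splitSetting boxRegion qDatumSplit s ↔
      ∀ (i : Fin splitIndex.lstar) (vQ : splitIndex.VQ), (2 : ℝ) ^ ((i : ℕ) + 1) - 1 ≤ s i vQ := by
  refine forall₂_congr fun i vQ => ?_
  rw [split_inflation i vQ]

/-- In particular the ZERO cap FAILS at P♮₁ (it holds at CM, `CandMochizuki30.H_pinned_zero`): the (Ind1)-orbit inflates the hull. [folklore] -/
theorem not_M06_zero_split : ¬ CandMochizuki30.H splitFull.toLatticeSituation splitSetting boxRegion qDatumSplit (fun _ _ => 0) := by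
  rw [M06_split_iff]
  intro h
  have h0 := h ⟨0, by decide⟩ ()
  norm_num at h0

/-- … while the cap `s_j := 2^j − 1` holds with equality. [folklore] -/
theorem M06_split_exact :
    CandMochizuki30.H splitFull.toLatticeSituation splitSetting boxRegion qDatumSplit fun i _ => (2 : ℝ) ^ ((i : ℕ) + 1) - 1 :=
  (M06_split_iff _).2 fun _ _ => le_rfl

/-- The log-volume of the region `ρ Ψ` of the Θ-datum at a label of `𝔽_l^⋇` equals the q-pilot's local volume (both boxes have `#DTheta j` deep
coordinates; the capsule swap is an isometry). [folklore] -/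
theorem split_rhoPsi_logvol (i : Fin splitIndex.lstar) (vQ : splitIndex.VQ) :
    (splitFull.toLatticeSituation.D splitSetting.n).logvol _ vQ
        (boxRegion (splitFull.toLatticeSituation.D splitSetting.n).Ψ (Setting.labelSucc i) vQ) =
      splitSetting.qLocal (Setting.labelSucc i) vQ := by
  have hj := Setting.labelSucc_ne_zero i
  rw [show boxRegion (splitFull.toLatticeSituation.D splitSetting.n).Ψ (Setting.labelSucc i) vQ = box (DTheta _) from boxRegion_theta hj vQ,
    splitSetting_qLocal]
  exact splitVol_box_DTheta hj vQ

/-- **RP-M31 at P♮₁: the `N`-th-power scaling class `H N` FAILS for EVERY `N`** — at the label `2` the Θ-region and the q-region have the SAME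
volume `−5 ≠ 0`, so `N·4 = 1` would be forced. P♮₁ lies outside every `N·j²`-scaled class (its Θ/q volume ratio is `1`). [folklore] -/
theorem not_M31_split (N : ℕ) : ¬ CandMochizuki31.H splitFull.toLatticeSituation splitSetting boxRegion qDatumSplit N := by
  intro h
  have h2 := h ⟨1, by decide⟩ ()
  rw [split_rhoPsi_logvol, splitSetting_qLocal, card_DTheta] at h2
  push_cast at h2
  have hN : (4 : ℝ) * N = 1 := by nlinarith
  have hN' : (4 * N : ℕ) = 1 := by exact_mod_cast hN
  omega

/-! ## 3. The m3 package and the SAT♮₁ grade -/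

/-- **THE P♮₁ COLUMN OF rp-m3's ROWS, packaged**: S ∧ ¬IdentifiedReading (w5-d230) ∧ `H` ∧ `H'` ∧ `H''` ∧ ¬`AO4` ∧ ¬(cap 0) ∧ (cap `2^j − 1`) ∧
¬`H 1` ∧ ¬`H 2` (`not_M31_split` for every `N`). [claim: Mochizuki2012, status: disputed] -/
theorem profile_split_m3 :
    PilotKummerIndRelated splitFull.toLatticeSituation splitSetting boxRegion qDatumSplit ∧ ¬ splitSetting.IdentifiedReading ∧
      H splitFull.toLatticeSituation splitSetting boxRegion qDatumSplit ∧ H' splitFull.toLatticeSituation splitSetting boxRegion qDatumSplit ∧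
      H'' splitFull.toLatticeSituation splitSetting boxRegion qDatumSplit ∧
      ¬ CandMochizuki33.AO4 splitFull.toLatticeSituation splitSetting boxRegion qDatumSplit ∧
      ¬ CandMochizuki30.H splitFull.toLatticeSituation splitSetting boxRegion qDatumSplit (fun _ _ => 0) ∧
      CandMochizuki30.H splitFull.toLatticeSituation splitSetting boxRegion qDatumSplit (fun i _ => (2 : ℝ) ^ ((i : ℕ) + 1) - 1) ∧
      ¬ CandMochizuki31.H splitFull.toLatticeSituation splitSetting boxRegion qDatumSplit 1 ∧
      ¬ CandMochizuki31.H splitFull.toLatticeSituation splitSetting boxRegion qDatumSplit 2 :=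
  ⟨splitSetting_pilotKummerIndRelated, splitSetting_not_identifiedReading, M32a_split, M32b_split, M32c_split, not_AO4_split,
    not_M06_zero_split, M06_split_exact, not_M31_split 1, not_M31_split 2⟩

/-- **T-c grade SAT♮₁ for the hull row RP-M32c** through w5-d230's engine (one `exact`): `H''` is jointly satisfiable with typed Thm 3.11 ∧
BridgeHyps ∧ `|log(q)| > 0` ∧ PinnedRegions3 ∧ all four levels of record ∧ the Statement STRICT ∧ ¬IdentifiedReading, the mover being print's
(Ind1). (Its SAT+ witnesses of record remain `rhoOne 2 3` and the frame flip.) [claim: Mochizuki2012, status: disputed] -/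
theorem M32c_satNatural₁ :
    ∃ (T : ThetaIndex) (F : FullSituation T) (P : Cor312.Setting F.toLatticeSituation.toSituation)
      (ρ : (∀ v : T.V, v ∈ T.Vbad → Set (F.L.StarPacket v)) → ∀ (j : T.Label) (vQ : T.VQ), Set (F.L.Packet j vQ))
      (qK : ∀ v : T.V, v ∈ T.Vbad → Set (F.L.StarPacket v)),
      F.Statement ∧ BridgeHyps P ∧ P.AbsLogQPos ∧ PinnedRegions3 F.toLatticeSituation P ρ qK ∧ H'' F.toLatticeSituation P ρ qK ∧
        PilotKummerCompat F.toLatticeSituation P qK ∧ PilotKummerCompatRegion F.toLatticeSituation P ρ qK ∧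
        PilotKummerIndRelated F.toLatticeSituation P ρ qK ∧ PilotKummerCompatHull F.toLatticeSituation P ρ qK ∧
        P.Statement ∧ ((P.negLogQ : ℝ) : WithTop ℝ) < P.negLogTheta ∧ ¬ P.IdentifiedReading :=
  satNatural₁_of_holds_at_splitSetting (fun S P ρ qK => H'' S P ρ qK) M32c_split

end Summit.ABC.IUTFork.Repair.CandMochizuki32Split

end
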